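import Mathlib
import HarnessLib
import Summits.Langlands.Langlands.Theses.ParityBlindBianchi
import Literature.NumberTheory.Automorphic.TwistedAsaiPole
import Literature.NumberTheory.Automorphic.UnitaryGroupAutomorphicRep
import Literature.NumberTheory.GaloisRepresentations.HeckeCharacter

/-!
# Sketch — first lemmas of the crux idea cards for `ParityBlindBianchi.QuadraticDescentGL2`
(crux item stmt-Langlands-16811; planner crux-ideate, round 1, ideator 1).

Statements (`Prop`s) over existing declarations; only the two compositions at the end are proved
(pure logic), to certify that the cut really concludes the crux BY NAME.

* §C card `theta-descent-asai-pole`: `TwistedAsaiPoleOfGalStable` (S2), `ThetaDescentOfTwistedAsaiPole`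
  (S3 = first lemma), `quadraticDescentGL2_of_theta` (S2 → S3 → crux, proved).
* §H card `unitary-avatar-gu11`: `GenericDescentTwo` (GRS at N = 2, the sibling crux's engine),
  `UnitaryAvatarDictionary` (first lemma: the accidental isomorphism GU(1,1) = (GL₂ × Res E^×)/F^× on
  Satake data), `ConjSelfDualTwistOfGalStable`.
* §A card `converse-ai-contradiction`: `IsWeakAIQuadratic` (a.e. automorphic-induction relation on
  Satake data), `DescentOfAutomorphicInduction` (first lemma: AI read backwards — the isobaric
  decomposition makes the coherent choice of square roots), `CuspidalAIOfNoDescent` (the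
  Cogdell–Piatetski-Shapiro engine, by contradiction), `quadraticDescentGL2_of_converse` (proved).
-/

namespace Summit.Langlands.Langlands.Cruxes.QuadraticDescentGL2.Sketch

open scoped BigOperators Classical
open Filter Set Function
open NumberField IsDedekindDomain
open Literature.NumberTheory.Automorphic Literature.NumberTheory.GaloisRepresentations
open Summit.Langlands.Langlands.Theses.ParityBlindBianchi (QuadraticDescentGL2)

/-! ## §0 plumbing -/

/-- A Galois quadratic extension has a non-trivial automorphism. [folklore] -/
theorem exists_ne_one_of_finrank_eq_two {F E : Type} [Field F] [Field E] [Algebra F E]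
    [IsGalois F E] (h2 : Module.finrank F E = 2) : ∃ c : E ≃ₐ[F] E, c ≠ 1 := by
  by_contra h
  push Not at h
  haveI : FiniteDimensional F E := Module.finite_of_finrank_pos (by omega)
  haveI hsub : Subsingleton (E ≃ₐ[F] E) := ⟨fun a b => by rw [h a, h b]⟩
  have hcard : Nat.card (E ≃ₐ[F] E) = 2 := by
    rw [IsGalois.card_aut_eq_finrank, h2]
  have h1 : Nat.card (E ≃ₐ[F] E) = 1 := Nat.card_of_subsingleton (1 : E ≃ₐ[F] E)
  omega

/-! ## §C — card `theta-descent-asai-pole` -/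

/-- **S2 (twisted Asai pole from Galois-stability).** For a cuspidal `P` on `GL₂(𝔸_E)`, `E/F`
quadratic with involution `c`, whose Satake data are `Gal(E/F)`-stable a.e., there are a Hecke
character `χ` of `F` with `ω_P = χ⁻¹ ∘ N_{E/F}` (rendered on Satake data: `e₂(t_{P,w}) · χ(ϖ_v)^{f(w|v)} = 1`
a.e.) and a sign `η` such that `L^S(s, P, As^η ⊗ χ)` has a pole at `s = 1`.
Content: `GL₁`-descent of the `c`-invariant central character (class field theory); the
Jacquet–Shalika pole of `L^S_E(s, P × P^∨)` (tree fact `JacquetShalika1981_partialPairL_pole_of_eq_conj`);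
`P^∨ ≅ P ⊗ ω_P⁻¹` (exact on `GL₂` Satake data) and `P ≅ P^c`, so
`L^S_E(s, P × P^∨) = L^S_F(s, As⁺ ⊗ χ) · L^S_F(s, As⁻ ⊗ χ)` (tree: `partialPairL_smul_eq_partialAsaiL_mul`
composed with `partialAsaiL_twist_eq_partialAsaiLTwist`); meromorphy of the two twisted partial Asai
functions at `1` (Flicker 1988 Thm p. 297; for `N = 2` the raw-product currency is harmless). -/
def TwistedAsaiPoleOfGalStable : Prop :=
  ∀ (F E : Type) [Field F] [NumberField F] [Field E] [NumberField E] [Algebra F E]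
    (c : E ≃ₐ[F] E), Module.finrank F E = 2 → c ≠ 1 →
    ∀ (hE : isCompact_glFiniteIntegralLevel 2 E) (P : CuspidalAutomorphicRepData 2 E hE),
      IsGaloisStableSatakeAE F P.1 →
      ∃ (χ : HeckeCharacter F) (η : ℤˣ),
        (∀ᶠ w : HeightOneSpectrum (𝓞 E) in cofinite, ∀ α : Multiset ℂ,
          P.1.HasSatakeParamAt w α → χ.IsUnramifiedAt (w.under (𝓞 F)) →
            α.prod * χ.valueAtUniformizer (w.under (𝓞 F)) ^ w.asIdeal.inertiaDeg (𝓞 F) = 1) ∧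
        P.1.HasHeckeTwistedAsaiPole c χ η

/-- **S3 = FIRST LEMMA (theta descent from a twisted Asai pole; Takeda 2009 Thm 1.3 (proof, §7 ¶1–2)
with Thm 1.4 (1), Roberts 2001 Lemma 8.1, Kudla–Rallis 1994 Thm 7.2.5, Rallis 1984 (tower),
Takeda §6 (unramified `GO(4) → GSp(1)` correspondence = base change)).** For a cuspidal `P` on
`GL₂(𝔸_E)` with `ω_P = χ⁻¹ ∘ N_{E/F}` (a.e. on Satake data) and `L^S(s, P, As^η ⊗ χ)` having a pole at
`s = 1`, there is a cuspidal `π` on `GL₂(𝔸_F)` of which `P` is a weak base-change lift. Mechanism: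
`(P, χ⁻¹η_{E/F}^{(1-η)/2})` is a cuspidal representation of `GSO(X_E)(𝔸) = (GL₂(𝔸_E) × 𝔸_F^×)/𝔸_E^×`
(`X_E` the 4-dimensional quadratic space of discriminant `E`); its standard `L`-function IS the twisted
Asai `L`-function; generic ⟹ an extension `σ` to `GO(X_E)(𝔸)` with `Θ_{GSp(4)}(σ) ≠ 0`; the pole forces
`Θ_{GL₂}(σ) ≠ 0` (else a cuspidal `Sp(4)`-lift with a double pole of its standard `L`-function), and the
unramified theta correspondence `GO(X_E) ↔ GL₂` is quadratic base change on Satake parameters. No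
trace formula; Flicker 1988 §5 / Takeda Prop. 7.1 are NOT used (their `pole ⟹ BC` step cites Langlands). -/
def ThetaDescentOfTwistedAsaiPole : Prop :=
  ∀ (F E : Type) [Field F] [NumberField F] [Field E] [NumberField E] [Algebra F E]
    (c : E ≃ₐ[F] E), Module.finrank F E = 2 → c ≠ 1 →
    ∀ (hF : isCompact_glFiniteIntegralLevel 2 F) (hE : isCompact_glFiniteIntegralLevel 2 E)
      (P : CuspidalAutomorphicRepData 2 E hE) (χ : HeckeCharacter F) (η : ℤˣ),
      (∀ᶠ w : HeightOneSpectrum (𝓞 E) in cofinite, ∀ α : Multiset ℂ,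
          P.1.HasSatakeParamAt w α → χ.IsUnramifiedAt (w.under (𝓞 F)) →
            α.prod * χ.valueAtUniformizer (w.under (𝓞 F)) ^ w.asIdeal.inertiaDeg (𝓞 F) = 1) →
      P.1.HasHeckeTwistedAsaiPole c χ η →
      ∃ π : CuspidalAutomorphicRepData 2 F hF, IsWeakBaseChangeLiftAE π.1 P.1

/-- **Card C composition (proved, pure logic): S2 → S3 → the crux BY NAME.** [folklore] -/
theorem quadraticDescentGL2_of_theta (hS2 : TwistedAsaiPoleOfGalStable)
    (hS3 : ThetaDescentOfTwistedAsaiPole) : QuadraticDescentGL2 := by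
  intro F E _ _ _ _ _ _ hfin hF hE P hst
  obtain ⟨c, hc⟩ := exists_ne_one_of_finrank_eq_two hfin
  obtain ⟨χ, η, hcc, hpole⟩ := hS2 F E c hfin hc hE P hst
  exact hS3 F E c hfin hc hF hE P χ η hcc hpole

/-! ## §H — card `unitary-avatar-gu11` -/

/-- **GRS descent at `N = 2`** (the sibling crux `HostInducedRep`'s engine `GenericDescent`,
Cruxes/HostInducedRep/SketchIdeator3.lean §2, specialised): a conjugate self-dual (a.e.) cuspidal `P`
on `GL₂/E` with the standard Asai sign is a weak base change (Mok's `ξ₁` on Satake data) of a cuspidal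
automorphic representation of the quasi-split `U_{E/F}(2) = U(1,1)` — by the Ginzburg–Rallis–Soudry
descent (residue at `s = 1/2`... of the Siegel Eisenstein series on `U(2,2)` induced from `P|det|^s`,
Fourier–Jacobi coefficient to `U(1,1)`; non-vanishing from the genericity of `P`, no trace formula). -/
def GenericDescentTwo : Prop :=
  ∀ (F E : Type) [Field F] [NumberField F] [Field E] [NumberField E] [Algebra F E]
    (c : E ≃ₐ[F] E), Module.finrank F E = 2 → c ≠ 1 →
    ∀ (hE : isCompact_glFiniteIntegralLevel 2 E) (P : CuspidalAutomorphicRepData 2 E hE),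
      P.1.IsConjSelfDualAE c → P.1.HasAsaiSign c 1 →
      ∃ σ : UnitaryGroup.CuspidalAutomorphicRepData F E c 2 hE,
        UnitaryGroup.IsWeakBaseChange F E c 2 hE P.1 σ.1

/-- **FIRST LEMMA of card H (the accidental isomorphism `GU(1,1) ≅ (GL₂ × Res_{E/F} 𝔾_m)/𝔾_m` on
automorphic representations, unramified-parameter form).** If the cuspidal `P` on `GL₂/E` is a weak
base change of a cuspidal `σ` on the quasi-split `U_{E/F}(2)`, then — extending `σ` from `U(1,1)(𝔸_F)`
to `GU(1,1)(𝔸_F)` (central character extension + finite induction, Labesse / Clozel–Harris–Labesse)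
and reading the extension through the isomorphism as a pair `(π, λ)`, `π` cuspidal on `GL₂(𝔸_F)`,
`λ` a Hecke character of `E`, `ω_π = λ|_{𝔸_F^×}` — one has `BC_{U}(σ) = BC_{E/F}(π) ⊗ \bar λ⁻¹` on Satake
data: `P ⊗ ξ` is a weak base-change lift of `π` for the Hecke character `ξ = \bar λ` of `E`
(`t_{P,w} · ξ(ϖ_w) = t_{π,v}^{f(w|v)}` a.e.). -/
def UnitaryAvatarDictionary : Prop :=
  ∀ (F E : Type) [Field F] [NumberField F] [Field E] [NumberField E] [Algebra F E]
    (c : E ≃ₐ[F] E), Module.finrank F E = 2 → c ≠ 1 →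
    ∀ (hF : isCompact_glFiniteIntegralLevel 2 F) (hE : isCompact_glFiniteIntegralLevel 2 E)
      (P : CuspidalAutomorphicRepData 2 E hE) (σ : UnitaryGroup.CuspidalAutomorphicRepData F E c 2 hE),
      UnitaryGroup.IsWeakBaseChange F E c 2 hE P.1 σ.1 →
      ∃ (π : CuspidalAutomorphicRepData 2 F hF) (ξ : HeckeCharacter E),
        ∀ᶠ w : HeightOneSpectrum (𝓞 E) in cofinite,
          ∀ (v : HeightOneSpectrum (𝓞 F)) (α β : Multiset ℂ), w.asIdeal.under (𝓞 F) = v.asIdeal →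
            π.1.HasSatakeParamAt v α → P.1.HasSatakeParamAt w β → ξ.IsUnramifiedAt w →
              β.map (· * ξ.valueAtUniformizer w) = α.map (· ^ w.asIdeal.inertiaDeg (𝓞 F))

/-- **H, step 0 (twist to conjugate self-duality).** A `Gal(E/F)`-stable cuspidal `P` on `GL₂/E` has a
twist `P ⊗ μ` by a Hecke character of `E` which is conjugate self-dual a.e. (`P^∨ ≅ P ⊗ ω_P⁻¹` on `GL₂`;
`ω_P = χ ∘ N` by `GL₁`-descent; take `μ` extending `χ⁻¹` from `C_F` to `C_E`, so `μ μ^c = (χ ∘ N)⁻¹`),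
rendered on Satake data: `t_{P, c w} μ(ϖ_{cw}) = (t_{P,w} μ(ϖ_w))⁻¹` a.e. -/
def ConjSelfDualTwistOfGalStable : Prop :=
  ∀ (F E : Type) [Field F] [NumberField F] [Field E] [NumberField E] [Algebra F E]
    (c : E ≃ₐ[F] E), Module.finrank F E = 2 → c ≠ 1 →
    ∀ (hE : isCompact_glFiniteIntegralLevel 2 E) (P : CuspidalAutomorphicRepData 2 E hE),
      IsGaloisStableSatakeAE F P.1 →
      ∃ μ : HeckeCharacter E, ∀ᶠ w : HeightOneSpectrum (𝓞 E) in cofinite, ∀ α β : Multiset ℂ,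
        P.1.HasSatakeParamAt w α → P.1.HasSatakeParamAt (c • w) β →
          μ.IsUnramifiedAt w → μ.IsUnramifiedAt (c • w) →
            β.map (· * μ.valueAtUniformizer (c • w)) = (α.map (· * μ.valueAtUniformizer w)).map (·⁻¹)

/-! ## §A — card `converse-ai-contradiction` -/

/-- **The a.e. automorphic-induction relation on Satake data** for `E/F` quadratic with involution `c`,
`P` on `GL₂/E`, `I` on `GL₄/F`: at almost every place `w` of `E`, with `v` below `w` — if `v` splits
(`f(w|v) = 1`), `t_{I,v} = t_{P,w} ⊔ t_{P,cw}`; if `v` is inert (`f(w|v) = 2`), `t_{I,v} = r ⊔ (-r)` for a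
multiset `r` of square roots of `t_{P,w}` (w.r.t. `q_v`, `q_w = q_v²`). (Arthur–Clozel III.6;
`I = AI_{E/F}(P)` has `L(s, I_v) = ∏_{w∣v} L(s, P_w)`.) -/
def IsWeakAIQuadratic {F E : Type} [Field F] [NumberField F] [Field E] [NumberField E] [Algebra F E]
    (c : E ≃ₐ[F] E) {hE : isCompact_glFiniteIntegralLevel 2 E} {hF4 : isCompact_glFiniteIntegralLevel 4 F}
    (P : AutomorphicRepData (AutomorphyDatum.gl 2 E hE))
    (I : AutomorphicRepData (AutomorphyDatum.gl 4 F hF4)) : Prop :=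
  ∀ᶠ w : HeightOneSpectrum (𝓞 E) in cofinite,
    ∀ (v : HeightOneSpectrum (𝓞 F)) (β : Multiset ℂ), w.asIdeal.under (𝓞 F) = v.asIdeal →
      I.HasSatakeParamAt v β →
        (w.asIdeal.inertiaDeg (𝓞 F) = 1 →
          ∃ α α' : Multiset ℂ, P.HasSatakeParamAt w α ∧ P.HasSatakeParamAt (c • w) α' ∧ β = α + α') ∧
        (w.asIdeal.inertiaDeg (𝓞 F) = 2 →
          ∃ α r : Multiset ℂ, P.HasSatakeParamAt w α ∧ r.map (· ^ 2) = α ∧ β = r + r.map (fun z => -z))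

/-- **FIRST LEMMA of card A (automorphic induction read backwards).** If the Satake data of the cuspidal
`P` on `GL₂/E` are `Gal(E/F)`-stable a.e. and SOME automorphic `I` on `GL₄/F` is a weak automorphic
induction of `P`, then `P` is a weak base change of a cuspidal `π` on `GL₂/F`. Mechanism: the formal
factorisation `L^S_F(s, I × I^∨) = L^S_E(s, P × P^∨) · L^S_E(s, P × P^{c∨})` has a DOUBLE pole
(Jacquet–Shalika, twice, by `P ≅ P^c`), so by the Jacquet–Shalika/Langlands classification `I` is
isobaric `π₁ ⊞ π₂` with `π_i` cuspidal on `GL₂/F` (a `GL₁` constituent `χ₀` would give a pole of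
`L^S_E(s, P ⊗ χ₀⁻¹∘N)`); then `L^S_E(s, P × BC(π₁)^∨) = L^S_F(s, I × π₁^∨)` has a pole and `P ≅ BC(π₁)`
a.e. (Jacquet–Shalika over `E`; `BC(π₁)` from the sibling crux `QuadraticBaseChangeGL2` (a),(c), or the
Eisenstein lift `χ ⊞ χ^c` when `π₁` is dihedral from `E`). The GLOBAL coherent choice of square roots
`±√t_{P,w}` at the inert places — the obstruction to any `GL₂`-converse-theorem proof of descent — is
made by the isobaric decomposition of `I`. -/
def DescentOfAutomorphicInduction : Prop :=
  ∀ (F E : Type) [Field F] [NumberField F] [Field E] [NumberField E] [Algebra F E]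
    (c : E ≃ₐ[F] E), Module.finrank F E = 2 → c ≠ 1 →
    ∀ (hF : isCompact_glFiniteIntegralLevel 2 F) (hE : isCompact_glFiniteIntegralLevel 2 E)
      (hF4 : isCompact_glFiniteIntegralLevel 4 F) (P : CuspidalAutomorphicRepData 2 E hE)
      (I : AutomorphicRepData (AutomorphyDatum.gl 4 F hF4)),
      IsGaloisStableSatakeAE F P.1 → IsWeakAIQuadratic c P.1 I →
      ∃ π : CuspidalAutomorphicRepData 2 F hF, IsWeakBaseChangeLiftAE π.1 P.1

/-- **The Cogdell–Piatetski-Shapiro engine, by contradiction.** If a cuspidal `P` on `GL₂/E` is NOT a weak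
base change of any cuspidal `π` on `GL₂/F`, then some CUSPIDAL `I` on `GL₄/F` is a weak automorphic
induction of `P`. Mechanism: for every cuspidal `τ` on `GL₂/F` (and `GL₁/F`) the Rankin–Selberg
`L`-function `L(s, P × BC(τ))` over `E` (Jacquet 1972) is ENTIRE — a pole would exhibit `P^∨`, hence `P`,
as a base change — bounded in strips with the functional equation of `L(s, AI(P) × τ)` (local factors of
pairs under local automorphic induction: Henniart–Herb 1995 / LLC, or Jacquet–Shalika 1985 stability);
so Cogdell–Piatetski-Shapiro's converse theorem for `GL₄` with `GL₂`-twists (Publ. IHES 79 (1994) /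
J. reine angew. Math. 507 (1999), Thm 2) makes `⊗_v AI(P_w)_v` CUSPIDAL automorphic. Under
`Gal`-stability this contradicts the double pole above — which is how `quadraticDescentGL2_of_converse`
uses it. No trace formula; this replaces Arthur–Clozel III.6.2 exactly where the line needs it. -/
def CuspidalAIOfNoDescent : Prop :=
  ∀ (F E : Type) [Field F] [NumberField F] [Field E] [NumberField E] [Algebra F E]
    (c : E ≃ₐ[F] E), Module.finrank F E = 2 → c ≠ 1 →
    ∀ (hF : isCompact_glFiniteIntegralLevel 2 F) (hE : isCompact_glFiniteIntegralLevel 2 E)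
      (hF4 : isCompact_glFiniteIntegralLevel 4 F) (P : CuspidalAutomorphicRepData 2 E hE),
      (¬ ∃ π : CuspidalAutomorphicRepData 2 F hF, IsWeakBaseChangeLiftAE π.1 P.1) →
      ∃ I : CuspidalAutomorphicRepData 4 F hF4, IsWeakAIQuadratic c P.1 I.1

/-- **Card A composition (proved, pure logic + excluded middle): the two halves give the crux BY NAME**
(the compactness datum for `GL₄/F` is the tree theorem `isCompact_glFiniteIntegralLevel_holds 4 F`).
[folklore] -/
theorem quadraticDescentGL2_of_converse
    (hA1 : DescentOfAutomorphicInduction) (hA2 : CuspidalAIOfNoDescent) : QuadraticDescentGL2 := by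
  intro F E _ _ _ _ _ _ hfin hF hE P hst
  obtain ⟨c, hc⟩ := exists_ne_one_of_finrank_eq_two hfin
  by_contra hno
  obtain ⟨I, hI⟩ := hA2 F E c hfin hc hF hE (isCompact_glFiniteIntegralLevel_holds 4 F) P hno
  exact hno (hA1 F E c hfin hc hF hE (isCompact_glFiniteIntegralLevel_holds 4 F) P I.1 hst hI)

end Summit.Langlands.Langlands.Cruxes.QuadraticDescentGL2.Sketch
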